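import Literature.Computability.Complexity.YatesZeta
import Literature.Computability.MetaComplexity.TruthTables
import HarnessLib

/-!
# Yates' algorithm on tables indexed by numbers (specification layer of the evaluation machine)

Literature / circuit complexity, continuing `YatesZeta.lean` (Yates' dynamic programming for
the zeta transform, `yatesIter`, and `SymPlus.count_eq_yatesIter`) towards the evaluation
machine of Williams' Lemma 4.2 (R. Williams, *Nonuniform ACC circuit lower bounds*, J. ACM 61
(2014), Lemma 4.2, Proof 2 and App. C). The machine holds the table `g : 2^[n] → ℕ` as a LIST
of `2ⁿ` entries in the order of the numbers `T < 2ⁿ` (binary digits = membership bits), and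
performs round `j` BLOCKWISE: the list is cut into chunks of `2^(j+1)` consecutive entries and
in each chunk the lower half is added entrywise onto the upper half — which is how a machine
with sequential access realises "`g_j(T) = g_{j-1}(T) + g_{j-1}(T ∖ {j})` for `j ∈ T`" (buffer
the lower half, replay it against the upper half). This file is the arithmetic of that layout:

* `finsetOfNat n T` (coordinates of the set bits), `testBit_of_boolFunEquivFin_symm` (the tree's
  enumeration of the cube `MetaComplexity.boolFunEquivFin` reads off binary digits, so the
  `T`-th assignment has support `finsetOfNat n T`), and the block-position lemmas
  `finsetOfNat_upper`, `finsetOfNat_sub_two_pow` (`T - 2ʲ ↔ erase j` on upper halves),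
  `testBit_eq_decide_mod` (bit `j` ↔ upper half of the chunk);
* `blockRound b m l` (the blockwise round, `b = 2ʲ`, `m` chunks) with its entrywise semantics
  `getD_blockRound`;
* `fTable S` (multiplicities of the terms of a `SYM⁺` circuit `S`), `gTable S k` (after `k`
  rounds), **`getD_gTable`**: entry `T` of `gTable S k` is `yatesIter f k (finsetOfNat n T)`;
  **`truthTable_eval_eq`**: `truthTable S.eval` is the list of `S.sym (gTable S n)[T]`,
  `T < 2ⁿ` — the output of the machine is the tree's truth table in the tree's order;
  `getD_gTable_le`: all entries are `≤ S.size` (fixed-width fields of `⌈log₂ (s+1)⌉` bits never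
  overflow).

## References

* R. Williams, *Nonuniform ACC circuit lower bounds*, J. ACM 61(1) (2014) 2:1–2:32, Lemma 4.2
  (Proof 2: Yates' algorithm; App. C: implementation on multitape machines) [Williams2014].
* F. Yates, *The Design and Analysis of Factorial Experiments*, Imperial Bureau of Soil
  Science, 1937 (the algorithm); D. E. Knuth, TAOCP Vol. 2, §4.6.4 (Yates' method).
-/

namespace Literature.Computability.Complexity

open Finset MetaComplexity

variable {n : ℕ}

/-! ### Numbers below `2ⁿ` as assignments and as sets of coordinates -/

/-- The set of coordinates `i < n` at which bit `i` of `T` is set. [folklore] -/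
def finsetOfNat (n T : ℕ) : Finset (Fin n) := univ.filter fun i => T.testBit i

/-- Membership in `finsetOfNat`. [folklore] -/
@[simp] theorem mem_finsetOfNat {T : ℕ} {i : Fin n} : i ∈ finsetOfNat n T ↔ T.testBit i = true := by
  simp [finsetOfNat]

/-- The standard enumeration of the cube reads off binary digits: the `i`-th coordinate of the
`T`-th assignment is bit `i` of `T`. [folklore] -/
theorem testBit_of_boolFunEquivFin_symm (T : Fin (2 ^ n)) (i : Fin n) :
    (boolFunEquivFin n).symm T i = (T : ℕ).testBit i := by
  have h : ((finFunctionFinEquiv.symm T i : Fin 2) : ℕ) = T / 2 ^ (i : ℕ) % 2 :=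
    finFunctionFinEquiv_symm_apply_val T i
  change (finFunctionFinEquiv.symm T i == 1) = _
  rw [Nat.testBit_eq_decide_div_mod_eq, ← h]
  generalize finFunctionFinEquiv.symm T i = x
  revert x
  decide

/-- Hence the support of the `T`-th assignment is `finsetOfNat n T`. [folklore] -/
theorem support_boolFunEquivFin_symm (T : Fin (2 ^ n)) :
    SymPlus.support ((boolFunEquivFin n).symm T) = finsetOfNat n T := by
  ext i
  simp [SymPlus.support, testBit_of_boolFunEquivFin_symm]

/-! ### Adding `2ʲ` to a number whose bit `j` is clear -/

/-- Bits below `j + 1` do not see multiples of `2^(j+1)`. [folklore] -/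
theorem testBit_two_pow_succ_mul_add (a b j i : ℕ) (hi : i ≤ j) :
    (2 ^ (j + 1) * a + b).testBit i = b.testBit i := by
  rw [Nat.testBit_eq_decide_div_mod_eq, Nat.testBit_eq_decide_div_mod_eq]
  have h : (2 ^ (j + 1) * a + b) / 2 ^ i = 2 ^ (j + 1 - i) * a + b / 2 ^ i := by
    rw [show 2 ^ (j + 1) * a = 2 ^ i * (2 ^ (j + 1 - i) * a) by
      rw [← mul_assoc, ← pow_add]; congr 2; omega]
    rw [Nat.mul_add_div (Nat.two_pow_pos i)]
  rw [h, show 2 ^ (j + 1 - i) * a = 2 * (2 ^ (j - i) * a) by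
    rw [← mul_assoc, ← pow_succ']; congr 2; omega, Nat.mul_add_mod]

/-- Bits above `j` of `2^(j+1) a + b` with `b < 2^(j+1)` are those of `a`. [folklore] -/
theorem testBit_two_pow_succ_mul_add_of_lt (a : ℕ) {b j : ℕ} (hb : b < 2 ^ (j + 1)) (i : ℕ)
    (hi : j < i) : (2 ^ (j + 1) * a + b).testBit i = a.testBit (i - (j + 1)) := by
  rw [Nat.testBit_two_pow_mul_add a hb, if_neg (by omega)]

/-- For `r < 2ʲ`, bit `i` of `2ʲ + r` is bit `i` of `r`, except bit `j` which is set. [folklore] -/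
theorem testBit_two_pow_add_of_lt {r j : ℕ} (hr : r < 2 ^ j) (i : ℕ) :
    (2 ^ j + r).testBit i = (decide (i = j) || r.testBit i) := by
  rcases lt_trichotomy i j with h | rfl | h
  · rw [Nat.testBit_two_pow_add_gt h]; simp [h.ne]
  · rw [Nat.testBit_two_pow_add_eq, Nat.testBit_lt_two_pow hr]; simp
  · have : 2 ^ j + r < 2 ^ i := by
      calc 2 ^ j + r < 2 ^ j + 2 ^ j := by omega
        _ = 2 ^ (j + 1) := by rw [pow_succ]; ring
        _ ≤ 2 ^ i := Nat.pow_le_pow_right two_pos h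
    rw [Nat.testBit_lt_two_pow this, Nat.testBit_lt_two_pow (hr.trans (Nat.pow_lt_pow_right
      one_lt_two (by omega)))]
    simp [h.ne']

/-- **Block positions.** Inside the chunk number `a` of length `2^(j+1)`, the position `2ʲ + r`
of the upper half (`r < 2ʲ`) has the bits of the position `r` of the lower half plus bit `j`:
as sets of coordinates, `insert j`. [folklore] -/
theorem finsetOfNat_upper (a : ℕ) {r j : ℕ} (hr : r < 2 ^ j) (hj : j < n) :
    finsetOfNat n (2 ^ (j + 1) * a + (2 ^ j + r)) =
      insert ⟨j, hj⟩ (finsetOfNat n (2 ^ (j + 1) * a + r)) := by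
  have hr' : 2 ^ j + r < 2 ^ (j + 1) := by rw [pow_succ]; omega
  have hr'' : r < 2 ^ (j + 1) := hr.trans (Nat.pow_lt_pow_right one_lt_two (Nat.lt_succ_self j))
  ext ⟨i, hi⟩
  simp only [mem_finsetOfNat, Finset.mem_insert, Fin.mk.injEq]
  rcases le_or_gt i j with h | h
  · rw [testBit_two_pow_succ_mul_add _ _ _ _ h, testBit_two_pow_succ_mul_add _ _ _ _ h,
      testBit_two_pow_add_of_lt hr]
    simp
  · rw [testBit_two_pow_succ_mul_add_of_lt _ hr' _ h, testBit_two_pow_succ_mul_add_of_lt _ hr'' _ h]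
    simp [h.ne']

/-- The lower position does not contain the coordinate `j`. [folklore] -/
theorem not_mem_finsetOfNat_lower (a : ℕ) {r j : ℕ} (hr : r < 2 ^ j) (hj : j < n) :
    (⟨j, hj⟩ : Fin n) ∉ finsetOfNat n (2 ^ (j + 1) * a + r) := by
  rw [mem_finsetOfNat, testBit_two_pow_succ_mul_add _ _ _ _ le_rfl, Nat.testBit_lt_two_pow hr]
  exact Bool.false_ne_true

/-! ### Tables and the blockwise round -/

/-- One round of Yates' algorithm at bit `j` on a table, blockwise: the table is cut into
chunks of `2 · b` entries (`b = 2ʲ`); in each chunk the lower half is kept and added entrywise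
onto the upper half ("`g_i(T) = g_{i-1}(T) + g_{i-1}(T ∖ {i})` for `i ∈ T`"; `m` chunks).
[cite: Williams2014, Lemma 4.2 (Proof 2)] -/
def blockRound (b : ℕ) : ℕ → List ℕ → List ℕ
  | 0, _ => []
  | m + 1, l => (l.take b ++ List.zipWith (· + ·) ((l.drop b).take b) (l.take b)) ++
      blockRound b m (l.drop (2 * b))

/-- Length of a round on a table of `m` full chunks. [folklore] -/
theorem length_blockRound (b : ℕ) : ∀ (m : ℕ) (l : List ℕ), l.length = m * (2 * b) →
    (blockRound b m l).length = l.length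
  | 0, l, h => by rw [Nat.zero_mul] at h; simp [blockRound, h]
  | m + 1, l, h => by
    have hlen : l.length = m * (2 * b) + 2 * b := by rw [h]; ring
    simp only [blockRound, List.length_append, List.length_take, List.length_zipWith,
      List.length_drop]
    rw [length_blockRound b m _ (by rw [List.length_drop]; omega), List.length_drop]
    omega

/-- **Semantics of the blockwise round**: entry `T` becomes `l[T] + l[T - b]` if `T` lies in
an upper half-chunk, and stays `l[T]` otherwise. [cite: Williams2014, Lemma 4.2 (Proof 2)] -/
theorem getD_blockRound {b : ℕ} (hb : 0 < b) : ∀ (m : ℕ) (l : List ℕ), l.length = m * (2 * b) →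
    ∀ T, T < l.length → (blockRound b m l).getD T 0 =
      if b ≤ T % (2 * b) then l.getD T 0 + l.getD (T - b) 0 else l.getD T 0
  | 0, l, h, T, hT => by rw [Nat.zero_mul] at h; omega
  | m + 1, l, h, T, hT => by
    have hlen : l.length = m * (2 * b) + 2 * b := by rw [h]; ring
    have hrest : (l.drop (2 * b)).length = m * (2 * b) := by rw [List.length_drop]; omega
    have hfirst : (l.take b ++ List.zipWith (· + ·) ((l.drop b).take b) (l.take b)).length =
        2 * b := by
      simp only [List.length_append, List.length_take, List.length_zipWith, List.length_drop]
      omega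
    rw [blockRound, List.getD_eq_getElem?_getD]
    rcases lt_or_ge T (2 * b) with hT2 | hT2
    · -- first chunk
      rw [List.getElem?_append_left (by rw [hfirst]; exact hT2), Nat.mod_eq_of_lt hT2]
      rcases lt_or_ge T b with hTb | hTb
      · rw [List.getElem?_append_left (by rw [List.length_take]; omega), if_neg (by omega),
          List.getElem?_take, if_pos hTb, ← List.getD_eq_getElem?_getD]
      · rw [List.getElem?_append_right (by rw [List.length_take]; omega), if_pos hTb,
          List.length_take, min_eq_left (by omega : b ≤ l.length), List.getElem?_zipWith,
          List.getElem?_take, if_pos (by omega : T - b < b), List.getElem?_drop,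
          show b + (T - b) = T by omega, List.getElem?_take, if_pos (by omega : T - b < b),
          List.getD_eq_getElem?_getD, List.getD_eq_getElem?_getD,
          List.getElem?_eq_getElem (show T < l.length by omega),
          List.getElem?_eq_getElem (show T - b < l.length by omega)]
        rfl
    · -- later chunks
      rw [List.getElem?_append_right (by rw [hfirst]; exact hT2), hfirst,
        ← List.getD_eq_getElem?_getD,
        getD_blockRound hb m (l.drop (2 * b)) hrest (T - 2 * b) (by rw [hrest]; omega),
        ← Nat.mod_eq_sub_mod hT2, List.getD_eq_getElem?_getD, List.getD_eq_getElem?_getD,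
        List.getD_eq_getElem?_getD (l := l), List.getD_eq_getElem?_getD (l := l),
        List.getElem?_drop, List.getElem?_drop, show 2 * b + (T - 2 * b) = T by omega]
      split_ifs with hc
      · have hle : T % (2 * b) ≤ T - 2 * b := by
          rw [Nat.mod_eq_sub_mod hT2]; exact Nat.mod_le _ _
        rw [show 2 * b + (T - 2 * b - b) = T - b by omega]
      · rfl

/-! ### Bit `k` and the two halves of a chunk -/

/-- Bit `k` of `T` is set iff `T mod 2^(k+1)` lies in the upper half. [folklore] -/
theorem testBit_eq_decide_mod (T k : ℕ) : T.testBit k = decide (2 ^ k ≤ T % 2 ^ (k + 1)) := by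
  have h1 : T.testBit k = (T % 2 ^ (k + 1)).testBit k := by
    rw [Nat.testBit_mod_two_pow]; simp
  rw [h1]
  set y := T % 2 ^ (k + 1) with hy
  have hy2 : y < 2 ^ (k + 1) := Nat.mod_lt _ (Nat.two_pow_pos _)
  clear_value y
  by_cases hk : 2 ^ k ≤ y
  · obtain ⟨r, rfl⟩ : ∃ r, y = 2 ^ k + r := ⟨y - 2 ^ k, by omega⟩
    have hr : r < 2 ^ k := by rw [pow_succ] at hy2; omega
    rw [Nat.testBit_two_pow_add_eq, Nat.testBit_lt_two_pow hr, decide_eq_true hk]; rfl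
  · rw [Nat.testBit_lt_two_pow (by omega), decide_eq_false hk]

/-- Clearing the set bit `k`: `finsetOfNat n (T - 2ᵏ) = (finsetOfNat n T).erase k`. [folklore] -/
theorem finsetOfNat_sub_two_pow {T k : ℕ} (hk : k < n) (hT : 2 ^ k ≤ T % 2 ^ (k + 1)) :
    finsetOfNat n (T - 2 ^ k) = (finsetOfNat n T).erase ⟨k, hk⟩ := by
  set a := T / 2 ^ (k + 1) with ha
  set r := T % 2 ^ (k + 1) - 2 ^ k with hr
  have hy2 : T % 2 ^ (k + 1) < 2 ^ (k + 1) := Nat.mod_lt _ (Nat.two_pow_pos _)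
  have hrk : r < 2 ^ k := by rw [pow_succ] at hy2; omega
  have hT' : T = 2 ^ (k + 1) * a + (2 ^ k + r) := by
    have := Nat.div_add_mod T (2 ^ (k + 1)); rw [← ha] at this; omega
  have hTs : T - 2 ^ k = 2 ^ (k + 1) * a + r := by omega
  rw [hTs, hT', finsetOfNat_upper a hrk hk, Finset.erase_insert (not_mem_finsetOfNat_lower a hrk hk)]

/-! ### The tables of the algorithm -/

/-- The **multiplicity table** `f`: entry `T < 2ⁿ` is the number of terms of `S` whose set of
variables is the set of coordinates of `T` (Williams 2014, Lemma 4.2, Proof 2: "`f(S)` = the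
number of AND gates with input set `S`"). [cite: Williams2014, Lemma 4.2 (Proof 2)] -/
def fTable (S : SymPlus n) : List ℕ := (List.range (2 ^ n)).map fun T => S.terms.count (finsetOfNat n T)

/-- The table after `k` rounds (rounds at bits `0, …, k-1`; rounds beyond `n` do nothing).
[cite: Williams2014, Lemma 4.2 (Proof 2)] -/
def gTable (S : SymPlus n) : ℕ → List ℕ
  | 0 => fTable S
  | k + 1 => if k < n then blockRound (2 ^ k) (2 ^ n / 2 ^ (k + 1)) (gTable S k) else gTable S k

/-- The length of the multiplicity table. [folklore] -/
@[simp] theorem length_fTable (S : SymPlus n) : (fTable S).length = 2 ^ n := by simp [fTable]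

/-- `2ⁿ` consists of `2ⁿ / 2^(k+1)` chunks of `2 · 2ᵏ` entries (`k < n`). [folklore] -/
theorem two_pow_eq_chunks {k : ℕ} (hk : k < n) : 2 ^ n = 2 ^ n / 2 ^ (k + 1) * (2 * 2 ^ k) := by
  rw [← pow_succ', Nat.div_mul_cancel (pow_dvd_pow 2 hk)]

/-- The tables have length `2ⁿ`. [folklore] -/
@[simp] theorem length_gTable (S : SymPlus n) : ∀ k, (gTable S k).length = 2 ^ n
  | 0 => length_fTable S
  | k + 1 => by
    simp only [gTable]
    split_ifs with hk
    · rw [length_blockRound _ _ _ (by rw [length_gTable S k]; exact two_pow_eq_chunks hk),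
        length_gTable S k]
    · exact length_gTable S k

/-- **The rounds compute Yates' iterates**: entry `T` of the table after `k` rounds is
`yatesIter f k` at the set of coordinates of `T` (`YatesZeta.lean`). [cite: Williams2014, Lemma 4.2 (Proof 2)] -/
theorem getD_gTable (S : SymPlus n) : ∀ (k T : ℕ), T < 2 ^ n →
    (gTable S k).getD T 0 = yatesIter (fun U => S.terms.count U) k (finsetOfNat n T)
  | 0, T, hT => by
    rw [gTable, fTable, List.getD_eq_getElem?_getD, List.getElem?_map, List.getElem?_range hT]
    rfl
  | k + 1, T, hT => by
    simp only [gTable, yatesIter]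
    split_ifs with hk
    · rw [getD_blockRound (Nat.two_pow_pos k) _ _ (by rw [length_gTable]; exact two_pow_eq_chunks hk)
        T (by rw [length_gTable]; exact hT), yatesStep]
      have hiff : (⟨k, hk⟩ : Fin n) ∈ finsetOfNat n T ↔ 2 ^ k ≤ T % (2 * 2 ^ k) := by
        rw [mem_finsetOfNat, testBit_eq_decide_mod, decide_eq_true_iff, pow_succ']
      by_cases hbit : 2 ^ k ≤ T % (2 * 2 ^ k)
      · rw [if_pos hbit, if_pos (hiff.2 hbit), getD_gTable S k T hT,
          getD_gTable S k (T - 2 ^ k) ((Nat.sub_le T (2 ^ k)).trans_lt hT),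
          finsetOfNat_sub_two_pow hk (by rwa [pow_succ'])]
      · rw [if_neg hbit, if_neg (fun h => hbit (hiff.1 h))]
        exact getD_gTable S k T hT
    · exact getD_gTable S k T hT

/-- In particular, after `n` rounds entry `T` is the number of terms true at the `T`-th
assignment. [cite: Williams2014, Lemma 4.2 (Proof 2)] -/
theorem getD_gTable_n (S : SymPlus n) (T : ℕ) (hT : T < 2 ^ n) :
    (gTable S n).getD T 0 = S.count ((boolFunEquivFin n).symm ⟨T, hT⟩) := by
  rw [getD_gTable S n T hT, SymPlus.count_eq_yatesIter, support_boolFunEquivFin_symm]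

/-- **The truth table from the final table**: bit `T` of `truthTable S.eval` is the value of the
symmetric gate at entry `T` of the table after `n` rounds (Williams 2014, Lemma 4.2: "`V[i] = 1`
iff the `SYM⁺` circuit outputs `1` on the `i`th variable assignment"). [cite: Williams2014, Lemma 4.2] -/
theorem truthTable_eval_eq (S : SymPlus n) :
    truthTable S.eval = (List.range (2 ^ n)).map fun T => S.sym ((gTable S n).getD T 0) := by
  refine List.ext_getElem (by simp [truthTable]) fun i h₁ h₂ => ?_
  rw [length_truthTable] at h₁
  simp only [truthTable, List.getElem_ofFn, List.getElem_map, List.getElem_range]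
  rw [getD_gTable_n S i h₁, SymPlus.eval]

/-- Yates' partial sums are partial: at most the full zeta transform. [folklore] -/
theorem yatesPartial_le_zetaTransform (f : Finset (Fin n) → ℕ) (k : ℕ) (T : Finset (Fin n)) :
    yatesPartial f k T ≤ zetaTransform f T :=
  Finset.sum_le_sum_of_subset (filter_subset _ _)

/-- **All entries stay below the number of terms** (so `⌈log₂ (s+1)⌉`-bit fields never
overflow). [cite: Williams2014, Lemma 4.2 (Proof 2)] -/
theorem getD_gTable_le (S : SymPlus n) (k T : ℕ) : (gTable S k).getD T 0 ≤ S.size := by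
  rcases lt_or_ge T (2 ^ n) with hT | hT
  · -- reduce to `k ≤ n`
    have key : ∀ k, k ≤ n → (gTable S k).getD T 0 ≤ S.size := by
      intro k hk
      rw [getD_gTable S k T hT, yatesIter_eq_partial _ k hk]
      exact (yatesPartial_le_zetaTransform _ _ _).trans (zetaTransform_count_le _ _)
    rcases le_or_gt k n with hk | hk
    · exact key k hk
    · have hstab : ∀ j, (gTable S (n + j)).getD T 0 = (gTable S n).getD T 0 := by
        intro j
        induction j with
        | zero => rfl
        | succ j ih => rw [Nat.add_succ, gTable, if_neg (by omega), ih]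
      obtain ⟨j, rfl⟩ := Nat.exists_eq_add_of_lt hk
      rw [show n + j + 1 = n + (j + 1) by omega, hstab (j + 1)]
      exact key n le_rfl
  · rw [List.getD_eq_default _ _ (by rw [length_gTable]; exact hT)]
    exact Nat.zero_le _

end Literature.Computability.Complexity
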